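import Literature.IUT.HodgeArakelov.MonoThetaProjective

/-!
# [IUTchII] Prop 1.5 (i) — `Prop15_i'`: discrete rigidity for projective systems of mono-theta ENVIRONMENTS
# (repair file of record `MonoThetaProjectiveR`)

Repair file (abc-iut cell, L6-lead ROW 2026-08-25T22:12:06Z to abc-iut-L6-t19; finding = abc-iut-L6-t23 R-9
2026-08-25T21:16:29Z + referee lane P, P4-F2) for the LANDED, frozen `MonoThetaProjective.lean` (p407497).
S. Mochizuki, *Inter-universal Teichmüller theory II*, kurims manuscript Dec. 2020, Prop. 1.5 (i) p. 29:
"Such a projective system [of mono-theta environments `… → M^Θ_{M'} → M^Θ_M → …`] is uniquely determined,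
up to isomorphism, by `X̲̲_k` [cf. Remark 1.5.1 below; the discrete rigidity property of [EtTh],
Corollary 2.19, (ii)]"; [EtTh] Cor. 2.19 (ii) (kurims manuscript p. 59; Comments (Mar 2022) (xxiv): the
display reads `α_M : M_M ⥲ M^•_M`): "any projective system `… → M^•_{M'} → M^•_M → …` — where … `M^•_M` is a
mod `M` mono-theta environment — is isomorphic to the above natural projective system"; and [EtTh] Def.
2.13 (ii) (kurims p. 44): "If `N'|N`, `M` is a mod `N` mono-theta environment, and `M'` is a mod `N'`
mono-theta environment, then we shall refer to as a morphism of mono-theta environments `M → M'` any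
isomorphism `M_{N'} ⥲ M'`, where we write `M_{N'}` for the mod `N'` mono-theta environment induced by `M`."

THE DEFECT (t23): the frozen `MonoThetaProjSystem` carries its transition maps `trans` as bare continuous
homomorphisms `Π_{M^Θ_{M'}} → Π_{M^Θ_M}` ("here only the underlying homomorphisms … are carried"), whereas
print's arrows are MORPHISMS of mono-theta environments; over bare homomorphisms `Prop15_i A B` (any two
systems are compatibly isomorphic) is refutable inside the interface by TWISTING the transitions of a
system by Kummer-shift automorphisms `φ_M ∈ Aut(Π_M)` chosen incompatibly in `M` (t23's argument, INBOX
2026-08-25T21:16:29Z: the shifts move the theta sections, so the twisted arrows are not morphisms of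
mono-theta environments, and no compatible family of `MonoThetaEnv.Iso` can exist) — no kernel witness is
given here (it needs the theta sections of a genuine model; docstring pointer only).

THE REPAIR typed here, in the normal form of the tree's L2 encoding (`EtaleTheta.ThetaSystems`:
`MTESystem` = models with transitions `a_{M',M} ∘ red_{M',M}`, `a_{M',M}` underlying an automorphism of the
mono-theta environment `M_M`; `Cor219_ii`): the MODEL reductions `red_{M',M}` of the model family
([EtTh] Def. 2.13 (ii) "the mod `N'` mono-theta environment induced by `M`"; L2: `ThetaEnvTower.redEnv`,
TODO-merge:abc-iut-L2-t2) as an interface `ModelFamily.Reductions` on the frozen `ModelFamily`; the model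
environments `ModelFamily.modelEnv`; the predicate `MonoThetaProjSystem.IsMonoThetaCompatible` = "every
transition is the underlying map of a morphism of mono-theta environments" = "up to isomorphisms of
mono-theta environments with the models at both ends, the transition IS the model reduction"; and
`Prop15_i'` = `Prop15_i` for COMPATIBLE systems, with the disclosure lemma `prop15_i'_of_prop15_i` (the
frozen `Prop15_i` is the stronger, refutable statement). Names `Prop15_i'`, `IsMonoThetaCompatible`
reserved to this file (ruling 22:12:06Z). Claim key `Mochizuki2012`, status DISPUTED (D-0012): typing only;
nothing here takes a side on [IUTchIII] Cor. 3.12 (typed ≠ discharged).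
-/

namespace Literature.IUT.HodgeArakelov

universe u

variable {S : ThetaSetting.{u}}

/-! ## The model reductions of a model family ([EtTh] Def. 2.13 (ii)) -/

/-- **[EtTh] Def. 2.13 (ii)** (kurims p. 44) "`M_{N'}`, the mod `N'` mono-theta environment induced by `M`",
at the MODELS of a model family: the reduction maps `Π^tp_{Y̲}[μ_{M'}] → Π^tp_{Y̲}[μ_M]` (`M ∣ M'`; the identity
on `Π^tp_{Y̲}`, the natural surjection `μ_{M'} ↠ μ_M` on the cyclotomes), functorial in `M`, carrying the model
subgroup `D_Y` into `D_Y` and the `μ_{M'}`-conjugacy class of theta sections onto the `μ_M`-conjugacy class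
([EtTh] Cor. 2.18 (iv), first half: "functorial group-theoretic algorithm"). INTERFACE on the frozen
`ModelFamily` (the tree's CONSTRUCTION of these maps is abc-iut-L2-t2's `EtaleTheta.ThetaEnvTower.redEnv`;
TODO-merge:abc-iut-L2-t2). [claim: Mochizuki2012, status: disputed] (IUTchII §1 Prop 1.5, kurims p.29)
[cite: Mochizuki2012, Prop 1.5 (i) p.29] -/
structure ModelFamily.Reductions (F : ModelFamily S) : Type u where
  /-- `red_{M',M} : Π^tp_{Y̲}[μ_{M'}] → Π^tp_{Y̲}[μ_M]` for `M ∣ M'` -/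
  red : ∀ {M M' : ℕ+}, (M : ℕ) ∣ (M' : ℕ) → (F.modelPi M' →* F.modelPi M)
  red_continuous : ∀ {M M' : ℕ+} (h : (M : ℕ) ∣ (M' : ℕ)), Continuous (red h)
  red_surjective : ∀ {M M' : ℕ+} (h : (M : ℕ) ∣ (M' : ℕ)), Function.Surjective (red h)
  /-- functoriality: `red_{M,M} = id`, `red_{M',M} ∘ red_{M'',M'} = red_{M'',M}` -/
  red_refl : ∀ (M : ℕ+) (x : F.modelPi M), red (dvd_refl (M : ℕ)) x = x
  red_comp : ∀ {M M' M'' : ℕ+} (h : (M : ℕ) ∣ (M' : ℕ)) (h' : (M' : ℕ) ∣ (M'' : ℕ)) (x : F.modelPi M''),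
    red h (red h' x) = red (dvd_trans h h') x
  /-- `D_Y` at level `M'` induces `D_Y` at level `M` along `red` ([EtTh] Cor. 2.18 (iv), first half) -/
  red_D : ∀ {M M' : ℕ+} (h : (M : ℕ) ∣ (M' : ℕ)), ∀ φ' ∈ F.modelD M', ∃ φ ∈ F.modelD M,
    ∀ x, red h (φ' x) = φ (red h x)
  /-- the `μ_{M'}`-conjugacy class of theta sections maps onto the `μ_M`-conjugacy class -/
  red_theta : ∀ {M M' : ℕ+} (h : (M : ℕ) ∣ (M' : ℕ)),
    (fun H : Subgroup (F.modelPi M') => H.map (red h)) '' F.modelTheta M' = F.modelTheta M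

/-- The MODEL mod-`M` mono-theta environment of the family, as a `MonoThetaEnv (F.setting M)` (the identity
isomorphism witnesses "isomorphic to the model"; [EtTh] Def. 2.13 (ii): "every model mono-theta environment
determines a mono-theta environment"). [claim: Mochizuki2012, status: disputed] (IUTchII §1 Prop 1.5, kurims p.29)
[cite: Mochizuki2012, Prop 1.5 (i) p.29] -/
def ModelFamily.modelEnv (F : ModelFamily S) (M : ℕ+) : MonoThetaEnv (F.setting M) where
  Pi := F.modelPi M
  D := F.modelD M
  D_inn := F.modelD_inn M
  D_continuous := F.modelD_continuous M
  theta := F.modelTheta M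
  isModel := by
    -- the identity of `Π^tp_{Y̲}[μ_M]`, read as an isomorphism onto the model of `F.setting M`
    let e : F.modelPi M ≃ₜ* (F.setting M).modelPi := ContinuousMulEquiv.refl _
    refine ⟨e, ?_, ?_⟩
    · -- `D_Y` is carried to itself by conjugation with the identity
      ext φ
      rw [Subgroup.mem_map]
      constructor
      · rintro ⟨ψ, hψ, rfl⟩
        have hid : (MulAut.congr e.toMulEquiv).toMonoidHom ψ = ψ := by
          ext x
          rfl
        rw [hid]
        exact hψ
      · intro hφ
        refine ⟨φ, hφ, ?_⟩
        ext x
        rfl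
    · -- the theta sections are carried to themselves by the identity
      ext H
      rw [Set.mem_image]
      constructor
      · rintro ⟨K, hK, rfl⟩
        have hid : K.map e.toMulEquiv.toMonoidHom = K := by
          ext x
          constructor
          · rintro ⟨y, hy, hyx⟩
            rw [← hyx]
            exact hy
          · intro hx
            exact ⟨x, hx, rfl⟩
        rw [hid]
        exact hK
      · intro hH
        refine ⟨H, hH, ?_⟩
        ext x
        constructor
        · rintro ⟨y, hy, hyx⟩
          rw [← hyx]
          exact hy
        · intro hx
          exact ⟨x, hx, rfl⟩

namespace MonoThetaProjSystem

variable {F : ModelFamily S}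

/-- **[EtTh] Def. 2.13 (ii) / IUTchII:Prop1.5** — a projective system "of mono-theta environments": every
transition `Π_{M^Θ_{M'}} → Π_{M^Θ_M}` of `Sys` is the UNDERLYING MAP OF A MORPHISM of mono-theta environments
`M^Θ_{M'} → M^Θ_M` ("any isomorphism `(M^Θ_{M'})_M ⥲ M^Θ_M`" composed with the reduction), i.e. — reading the
induced mod-`M` environment through the models — there are isomorphisms of mono-theta environments
`i' : M^Θ_{M'} ⥲ (model at M')`, `i : M^Θ_M ⥲ (model at M)` with `i ∘ trans = red_{M',M} ∘ i'`. This is the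
normal form of the tree's L2 encoding (`EtaleTheta.ThetaSystems.MTESystem`: transition `= a_{M',M} ∘ red_{M',M}`
with `a_{M',M}` underlying an automorphism of `M_M`). The frozen `MonoThetaProjSystem` does NOT require this
(its `trans` are bare continuous homomorphisms) — whence the repair. [claim: Mochizuki2012, status: disputed] (IUTchII §1 Prop 1.5, kurims p.29)
[cite: Mochizuki2012, Prop 1.5 (i) p.29] -/
def IsMonoThetaCompatible (R : F.Reductions) (Sys : MonoThetaProjSystem F) : Prop :=
  ∀ (M M' : ℕ+) (h : (M : ℕ) ∣ (M' : ℕ)),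
    ∃ (i' : MonoThetaEnv.Iso (Sys.env M') (F.modelEnv M')) (i : MonoThetaEnv.Iso (Sys.env M) (F.modelEnv M)),
      ∀ x : (Sys.env M').Pi, i.iso (Sys.trans h x) = R.red h (i'.iso x)

end MonoThetaProjSystem

/-- **IUTchII:Prop1.5(i)′** (kurims p. 29), REPAIRED typing (decl of record): "Such a projective system [OF
MONO-THETA ENVIRONMENTS] is uniquely determined, up to isomorphism, by `X̲̲_k` [… the discrete rigidity
property of [EtTh], Corollary 2.19, (ii)]" — any two projective systems over the same model family WHOSE
TRANSITIONS ARE MORPHISMS OF MONO-THETA ENVIRONMENTS (`IsMonoThetaCompatible`) are isomorphic by a compatible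
family of isomorphisms of mono-theta environments (the frozen conclusion `Prop15_i A B`). Content = [EtTh]
Cor. 2.19 (ii) (kurims p. 59; Comments (Mar 2022) (xxiv): `α_M : M_M ⥲ M^•_M`), i.e. the tree's
`EtaleTheta.ThetaTower.Cor219_ii` at the merge (the twists `a_{M',M}` straighten SIMULTANEOUSLY — the
compatibility above is per transition, the conclusion is one family). PREDICATE on `(R, A, B)`.
[claim: Mochizuki2012, status: disputed] (IUTchII §1 Prop 1.5 (i), kurims p.29) [cite: Mochizuki2012, Prop 1.5 (i) p.29] -/
def Prop15_i' {F : ModelFamily S} (R : F.Reductions) (A B : MonoThetaProjSystem F) : Prop :=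
  A.IsMonoThetaCompatible R → B.IsMonoThetaCompatible R → Prop15_i A B

/-- DISCLOSURE lemma: the frozen `Prop15_i` (bare homomorphisms) implies the repaired `Prop15_i'`; the
converse fails — `Prop15_i` is refutable by twisting transitions with Kummer shifts (abc-iut-L6-t23,
2026-08-25T21:16:29Z), which produces a system that is NOT `IsMonoThetaCompatible` (the shifts move the
theta sections), so the repaired statement is immune. [claim: Mochizuki2012, status: disputed] (IUTchII §1 Prop 1.5 (i), kurims p.29)
[cite: Mochizuki2012, Prop 1.5 (i) p.29] -/
theorem prop15_i'_of_prop15_i {F : ModelFamily S} (R : F.Reductions) {A B : MonoThetaProjSystem F}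
    (h : Prop15_i A B) : Prop15_i' R A B :=
  fun _ _ => h

/-- `Prop15_i'` is symmetric in the compatibility hypotheses' rôle: stated for `(A, B)` it is the printed
uniqueness once BOTH systems are systems of mono-theta environments; in particular it holds vacuously
when either system has a non-morphism transition (e.g. t23's twisted system). [claim: Mochizuki2012, status: disputed] (IUTchII §1 Prop 1.5 (i), kurims p.29)
[cite: Mochizuki2012, Prop 1.5 (i) p.29] -/
theorem prop15_i'_of_not_compatible {F : ModelFamily S} (R : F.Reductions) {A B : MonoThetaProjSystem F}
    (h : ¬ A.IsMonoThetaCompatible R ∨ ¬ B.IsMonoThetaCompatible R) : Prop15_i' R A B := by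
  intro hA hB
  rcases h with h | h
  · exact (h hA).elim
  · exact (h hB).elim

end Literature.IUT.HodgeArakelov
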